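import Literature.NumberTheory.Irrationality.Zudilin2014.FirstTaleArithmetic
import Literature.NumberTheory.DiophantineApproximation.FactorialRatioPrimeClasses

/-!
# Zudilin 2014, Lemma 7: the permutation-group saving of the first tale

Topic `Literature/NumberTheory/Irrationality/Zudilin2014` [Zudilin2014ZetaTwo, Section 4, Lemma 7].  Lemma 7 (with
`Φ_n = ∏ p^{φ(n/p)}`, `φ(n/p) = max_{σ ∈ S₄} ord_p Π(a,b)/Π(σa,b)`, proof: "a standard method, based on the
permutation group from Proposition 1") says that the forms `q(a,b)`, `D_{γ₁n}D_{γ₂n} p(a,b)` are divisible by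
`p^{ord_p Π(a,b)/Π(σa,b)}` for EVERY permutation `σ` of `a₁,…,a₄`.  PROVED here for general admissible integer
parameters, one `σ` at a time (the maximum over `σ` is then taken pointwise by the user):

* `padicValRat_formQ_ge` / **`pow_dvd_formQZ`**: `ord_p q(a,b) ≥ ord_p Π(a,b) − ord_p Π(σa,b)`, i.e.
  `p^e ∣ q(a,b)` whenever `e ≤ ord_p Π(a,b)/Π(σa,b)` — from the scaling law `q(σa,b)Π(a,b) = q(a,b)Π(σa,b)`
  (`formQ_perm`) and `q(σa,b) ∈ ℤ` (`formQ_eq_cast` for the admissible parameters `σa`);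
* **`pow_dvd_formPZ`**: the same for the integer `D_{M₁}D_{M₂} p(a,b)` whenever ONE pair `(M₁, M₂)` clears the
  denominators of both `p(a,b)` and `p(σa,b)` (at Zudilin's points `γ₁ n, γ₂ n` do);
* `padicValRat_Pi_eq` — for `p² >` the factorial arguments, `ord_p Π(a,b) = ⌊(b₄−a₄−1)/p⌋ − Σ_j ⌊(a_j−b_j)/p⌋`
  (one Legendre digit, tree lemma `RhinViola.padicValNat_factorial_of_lt_sq`), so that
  `ord_p Π(a,b)/Π(σa,b)` is the printed floor expression of Lemma 7.

Cell pub-zeta5 (HONEST FRAMING: systematic search; no irrationality claim unless certified).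
-/

noncomputable section

open Polynomial Finset
open Literature.NumberTheory.DiophantineApproximation (RhinViola.padicValNat_factorial_of_lt_sq)

namespace Literature.NumberTheory.Irrationality.Zudilin2014

variable {p : ℕ} [hp : Fact p.Prime]

/-! ### Valuation transfer along the scaling law -/

/-- If `Xσ · Π(a,b) = X · Π(σa,b)` with `Xσ` an integer (as a rational) and `X ≠ 0`, then
`ord_p X ≥ ord_p Π(a,b) − ord_p Π(σa,b)`. [cite: Zudilin2014ZetaTwo, proof of Lemma 7] -/
theorem padicValRat_ge_of_scaling {a b : Fin 4 → ℤ} (σ : Equiv.Perm (Fin 4)) {X : ℚ} {Z : ℤ}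
    (hscale : (Z : ℚ) * Pi a b = X * Pi (a ∘ σ) b) (hX : X ≠ 0) :
    padicValRat p (Pi a b) - padicValRat p (Pi (a ∘ σ) b) ≤ padicValRat p X := by
  have hPi := Pi_ne_zero a b
  have hPiσ := Pi_ne_zero (a ∘ σ) b
  have hZ : (Z : ℚ) ≠ 0 := by
    intro h0; rw [h0, zero_mul] at hscale
    exact mul_ne_zero hX hPiσ hscale.symm
  have e := congrArg (padicValRat p) hscale
  rw [padicValRat.mul hZ hPi, padicValRat.mul hX hPiσ, padicValRat.of_int] at e
  have h0 : (0 : ℤ) ≤ (padicValInt p Z : ℤ) := Int.natCast_nonneg _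
  linarith

/-- Divisibility form: if `Xσ · Π(a,b) = X · Π(σa,b)`, `X = (ZX : ℤ)`, `Xσ = (Z : ℤ)`, then
`p^e ∣ ZX` for every `e ≤ ord_p Π(a,b) − ord_p Π(σa,b)`. [cite: Zudilin2014ZetaTwo, proof of Lemma 7] -/
theorem pow_dvd_of_scaling {a b : Fin 4 → ℤ} (σ : Equiv.Perm (Fin 4)) {ZX Z : ℤ}
    (hscale : (Z : ℚ) * Pi a b = (ZX : ℚ) * Pi (a ∘ σ) b) {e : ℕ}
    (he : (e : ℤ) ≤ padicValRat p (Pi a b) - padicValRat p (Pi (a ∘ σ) b)) :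
    (p : ℤ) ^ e ∣ ZX := by
  rcases eq_or_ne ZX 0 with h0 | h0
  · rw [h0]; exact dvd_zero _
  · have hv := padicValRat_ge_of_scaling (p := p) σ hscale (by exact_mod_cast h0)
    rw [padicValRat.of_int] at hv
    exact (padicValInt_dvd_iff e ZX).2 (Or.inr (by exact_mod_cast he.trans hv))

/-! ### Lemma 7 for `q` -/

/-- **Zudilin 2014, Lemma 7 (for `q`)** [cite: Zudilin2014ZetaTwo, Lemma 7]: `ord_p q(a,b) ≥ ord_p Π(a,b)/Π(σa,b)`
for every permutation `σ` (when `q(a,b) ≠ 0`). -/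
theorem padicValRat_formQ_ge {a b : Fin 4 → ℤ} (h : Admissible a b) (σ : Equiv.Perm (Fin 4))
    (hq : formQ a b ≠ 0) :
    padicValRat p (Pi a b) - padicValRat p (Pi (a ∘ σ) b) ≤ padicValRat p (formQ a b) := by
  have e := formQ_perm h σ
  rw [formQ_eq_cast (h.perm σ)] at e
  exact padicValRat_ge_of_scaling σ e hq

/-- **Lemma 7 for `q`, divisibility form**: `p^e ∣ q(a,b)` (the integer `formQZ`) whenever
`e ≤ ord_p Π(a,b) − ord_p Π(σa,b)`. [cite: Zudilin2014ZetaTwo, Lemma 7] -/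
theorem pow_dvd_formQZ {a b : Fin 4 → ℤ} (h : Admissible a b) (σ : Equiv.Perm (Fin 4)) {e : ℕ}
    (he : (e : ℤ) ≤ padicValRat p (Pi a b) - padicValRat p (Pi (a ∘ σ) b)) :
    (p : ℤ) ^ e ∣ formQZ a b := by
  have hs := formQ_perm h σ
  rw [formQ_eq_cast (h.perm σ), formQ_eq_cast h] at hs
  exact pow_dvd_of_scaling σ hs he

/-! ### Lemma 7 for `p` -/

/-- **Zudilin 2014, Lemma 7 (for `p`), divisibility form** [cite: Zudilin2014ZetaTwo, Lemma 7]: if `(M₁, M₂)` clears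
the denominators of `p(a,b)` and of `p(σa,b)` (hypotheses of `formP_eq_cast` for `a` and for `σa`; note
`a₂*`, `d`, `b₄` are `σ`-invariant), then `p^e ∣ D_{M₁} D_{M₂} p(a,b)` (the integer `formPZ`) whenever
`e ≤ ord_p Π(a,b) − ord_p Π(σa,b)`. -/
theorem pow_dvd_formPZ {a b : Fin 4 → ℤ} (h : Admissible a b) (σ : Equiv.Perm (Fin 4)) {M₁ M₂ : ℕ}
    (hc : ∀ j : Fin 4, j ≠ 3 → (a j - b j).toNat ≤ M₁)
    (hcσ : ∀ j : Fin 4, j ≠ 3 → ((a ∘ σ) j - b j).toNat ≤ M₁)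
    (hK₁ : (b 3 - a2star a - 1).toNat ≤ M₁) (hK₂ : (b 3 - a2star a - 1).toNat ≤ M₂)
    (hd : dExp a b + 1 ≤ M₂) {e : ℕ}
    (he : (e : ℤ) ≤ padicValRat p (Pi a b) - padicValRat p (Pi (a ∘ σ) b)) :
    (p : ℤ) ^ e ∣ formPZ a b M₁ M₂ := by
  have hs := formP_perm h σ
  have e1 := formP_eq_cast h hc hK₁ hK₂ hd
  have e2 := formP_eq_cast (M₁ := M₁) (M₂ := M₂) (h.perm σ) hcσ (by rwa [a2star_perm]) (by rwa [a2star_perm])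
    (by rwa [dExp_perm])
  have hs' : (formPZ (a ∘ σ) b M₁ M₂ : ℚ) * Pi a b = (formPZ a b M₁ M₂ : ℚ) * Pi (a ∘ σ) b := by
    rw [← e1, ← e2]
    linear_combination (Nat.lcmUpto M₁ : ℚ) * Nat.lcmUpto M₂ * hs
  exact pow_dvd_of_scaling σ hs' he

/-! ### The valuation of `Π(a,b)` at a large prime -/

/-- One Legendre digit for `facZ`: `ord_p (m!) = ⌊m/p⌋` for `0 ≤ m < p²`. [cite: Zudilin2014ZetaTwo, proof of Lemma 7] -/
theorem padicValRat_facZ {m : ℤ} (hm : m.toNat < p ^ 2) :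
    padicValRat p (facZ m) = ((m.toNat / p : ℕ) : ℤ) := by
  rw [facZ, padicValRat.of_nat, RhinViola.padicValNat_factorial_of_lt_sq hm]

/-- **`ord_p Π(a,b) = ⌊(b₄−a₄−1)/p⌋ − ⌊(a₁−b₁)/p⌋ − ⌊(a₂−b₂)/p⌋ − ⌊(a₃−b₃)/p⌋`** when all four arguments are `< p²`
(one Legendre digit each) [cite: Zudilin2014ZetaTwo, proof of Lemma 7 (`φ(n/p) = max_σ ord_p Π(a,b)/Π(σa,b)`)]. -/
theorem padicValRat_Pi_eq {a b : Fin 4 → ℤ} (hN : (b 3 - a 3 - 1).toNat < p ^ 2)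
    (h0 : (a 0 - b 0).toNat < p ^ 2) (h1 : (a 1 - b 1).toNat < p ^ 2) (h2 : (a 2 - b 2).toNat < p ^ 2) :
    padicValRat p (Pi a b) =
      ((b 3 - a 3 - 1).toNat / p : ℕ) - ((a 0 - b 0).toNat / p : ℕ) - ((a 1 - b 1).toNat / p : ℕ)
        - ((a 2 - b 2).toNat / p : ℕ) := by
  have hf : ∀ m : ℤ, facZ m ≠ 0 := fun m => by unfold facZ; positivity
  unfold Pi numFac
  rw [padicValRat.div (hf _) (mul_ne_zero (mul_ne_zero (hf _) (hf _)) (hf _)),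
    padicValRat.mul (mul_ne_zero (hf _) (hf _)) (hf _), padicValRat.mul (hf _) (hf _),
    padicValRat_facZ hN, padicValRat_facZ h0, padicValRat_facZ h1, padicValRat_facZ h2]
  ring

end Literature.NumberTheory.Irrationality.Zudilin2014

end
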